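import Mathlib.Analysis.Complex.RealDeriv
import Mathlib.Analysis.Calculus.MeanValue
import Literature.Analysis.FluidPDE.PassiveScalarClassicalEnergy
import Literature.Analysis.FluidPDE.CheskidovAssemblyTools
import Literature.Analysis.FunctionSpaces.TorusSobolevNormProofs
import Literature.Analysis.FunctionSpaces.TorusSpectralWeakDerivative
import Literature.Analysis.FunctionSpaces.TorusFourierModes
import HarnessLib

/-!
# Cheskidov's scalar estimates, II: the heat phase and the frequency splitting
(arXiv:2311.04182, §4, (4.6)–(4.11))

Topic `Literature/Analysis/FluidPDE` (support file for the proof of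
`Literature.Analysis.FluidPDE.cheskidov_total_dissipation_family`). In Cheskidov's construction
the drift `v^m` vanishes on the final time window `[t_{m+1}, 2]`, so that there the viscous
scalar solves the **heat equation** `∂ₜθ^m = ν_mΔθ^m` ((4.9)); the total dissipation at time
`1` is then read off the Fourier side: low modes do not grow ((4.8)), high modes decay
exponentially ((4.10)–(4.11)), and the low modes at time `t_{m+1}` are small because `θ^m` is
`L²`-close to the inviscid profile `ρ^m` whose `Ḣ⁻¹` norm is small ((4.6)–(4.7)). This file
proves these three facts for an arbitrary classical passive scalar on `T^d` whose drift
vanishes on a time window: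

* `Torus.hasDerivWithinAt_mFourierCoeff_ofReal` — `d/dt θ̂(t)(k) = 𝓕(∂ₜθ(t))(k)` within a convex
  time set; `Torus.mFourierCoeff_ofReal_laplacian` — `𝓕(Δθ)(k) = -4π²|k|² θ̂(k)`;
* `Torus.IsClassicalScalarTransportOn.mFourierCoeff_eq_exp_mul` — on a window `[T₁, T₂]` where
  the drift vanishes, `θ̂(t)(k) = e^{-4π²ν|k|²(t-T₁)} θ̂(T₁)(k)` (Cheskidov 2023, (4.9)–(4.10));
* `Torus.IsClassicalScalarTransportOn.eLpNorm_sq_le_lowModes_add_exp` — the splitting estimate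
  `‖θ(t)‖²_{L²} ≤ ∑_{|k| ≤ N} |θ̂(T₁)(k)|² + e^{-8π²νN²(t-T₁)} ‖θ(T₁)‖²_{L²}`
  (Cheskidov 2023, (4.8) and (4.10): Parseval, low modes do not grow, modes off the
  frequency ball `Torus.freqBall N = {k : |k|² ≤ N²}` — the accepted truncation set of
  `TorusTrigPoly`, i.e. the source's `P_{≤Λ}` with `Λ = N` — have `|k|² > N²`);
* `Torus.lowModes_le_of_eHomSobolevSeminorm_le` — for a mean-zero `ρ`,
  `∑_{|k| ≤ N} |ρ̂(k)|² ≤ N² ‖ρ‖²_{Ḣ⁻¹}` (Cheskidov 2023, (4.6):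
  `‖P_{≤Λ}ρ‖_{L²} ≤ Λ‖P_{≤Λ}ρ‖_{H⁻¹}`), and `Torus.lowModes_le_two_mul_add` — the triangle
  inequality (4.7) in squared form.

The low-mode energy `Torus.lowModes N f = ∑_{k ∈ freqBall N} |f̂(k)|²` is the squared `L²` norm
of the accepted real Fourier truncation `Torus.scalarTruncate N f` (`TorusScalarTrigPoly`,
`integral_sq_scalarTruncate`), kept on the extended-real side (`‖·‖ₑ`), where Parseval is the
accepted `Torus.tsum_enorm_sq_mFourierCoeff_eq_eLpNorm_sq` and all sums converge. The window
hypothesis `T₁ < T₂` in the heat-phase lemmas is only used to restrict the solution to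
`[T₁, T₂]` (a set of unique differentiability); for `T₁ = T₂` the statements are trivial.

## References

* A. Cheskidov, *Dissipation anomaly and anomalous dissipation in incompressible fluid flows*,
  arXiv:2311.04182 (2023), §4, (4.6)–(4.11), p. 12–13.
* L. Grafakos, *Classical Fourier Analysis*, 3rd ed. (2014), Prop. 3.2.6 (8), Prop. 3.2.7
  (Fourier coefficients of derivatives; Plancherel on `T^d`).
-/

open MeasureTheory Set Filter UnitAddTorus
open _root_.Topology
open scoped InnerProductSpace ContDiff ENNReal NNReal

noncomputable section

namespace Literature.Analysis.FluidPDE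

namespace Torus

variable {d : Type*} [Fintype d] [DecidableEq d]

/-! ## Fourier coefficients of smooth real scalars: time derivatives and the Laplacian -/

omit [DecidableEq d] in
/-- **Time derivatives of Fourier coefficients.** For a real scalar field `θ` jointly smooth on
`S × T^d`, `S` convex, the Fourier coefficient `t ↦ θ̂(t)(k)` has one-sided derivative
`𝓕(∂ₜθ(t))(k)` within `S` (differentiation under the integral sign,
`Torus.IsSmoothSpaceTimeOn.hasDerivWithinAt_integral`; Cheskidov 2023, proof of Lemma 3.3 and
§4: the Fourier coefficients of a smooth solution are differentiable in time). [folklore] -/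
theorem hasDerivWithinAt_mFourierCoeff_ofReal {S : Set ℝ} {θ : ℝ → UnitAddTorus d → ℝ}
    (hθ : FunctionSpaces.Torus.IsSmoothSpaceTimeOn S θ) (hS : Convex ℝ S) (k : d → ℤ) {t : ℝ} (ht : t ∈ S) :
    HasDerivWithinAt (fun s => mFourierCoeff (fun x => (θ s x : ℂ)) k)
      (mFourierCoeff (fun x => ((FunctionSpaces.Torus.timeDerivWithin S θ t x : ℝ) : ℂ)) k) S t := by
  by_cases hacc : AccPt t (𝓟 S)
  swap
  · exact HasFDerivWithinAt.of_not_accPt hacc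
  have hU : UniqueDiffOn ℝ S :=
    uniqueDiffOn_convex hS (FunctionSpaces.Torus.interior_nonempty_of_convex_of_accPt hS ht hacc)
  set Φ : ℝ → UnitAddTorus d → ℂ := fun s x => (mFourier (-k) x : ℂ) * (θ s x : ℂ) with hΦ_def
  have hχ : FunctionSpaces.Torus.IsSmoothSpaceTimeOn S (fun (_ : ℝ) (x : UnitAddTorus d) => (mFourier (-k) x : ℂ)) :=
    FunctionSpaces.Torus.isSmoothSpaceTimeOn_const (FunctionSpaces.Torus.isSmooth_mFourier (-k)) S
  have hθC : FunctionSpaces.Torus.IsSmoothSpaceTimeOn S (fun s x => (θ s x : ℂ)) := hθ.clm_comp Complex.ofRealCLM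
  have hΦ : FunctionSpaces.Torus.IsSmoothSpaceTimeOn S Φ := ContDiffOn.mul hχ hθC
  have hE := hΦ.hasDerivWithinAt_integral hS ht
  have hcoef : ∀ (g : UnitAddTorus d → ℝ), mFourierCoeff (fun x => (g x : ℂ)) k =
      ∫ x, (mFourier (-k) x : ℂ) * (g x : ℂ) := fun g => by
    rw [FunctionSpaces.Torus.mFourierCoeff_eq_integral_volume]
    rfl
  have htd : ∀ x, FunctionSpaces.Torus.timeDerivWithin S Φ t x =
      (mFourier (-k) x : ℂ) * ((FunctionSpaces.Torus.timeDerivWithin S θ t x : ℝ) : ℂ) := by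
    intro x
    have h1 := ((hθ.hasDerivWithinAt_slice ht x).ofReal_comp).const_mul (mFourier (-k) x : ℂ)
    exact h1.derivWithin (hU t ht)
  have hfun : (fun s => mFourierCoeff (fun x => (θ s x : ℂ)) k) = fun s => ∫ x, Φ s x :=
    funext fun s => hcoef (θ s)
  rw [hfun, hcoef]
  simp_rw [← htd]
  exact hE

/-- **Fourier coefficients of the Laplacian**: `𝓕(Δθ)(k) = -4π²|k|² θ̂(k)` for a smooth real
scalar on `T^d` (`Δ = ∑ᵢ∂ᵢ∂ᵢ` and `𝓕(∂ⱼf)(k) = 2πi kⱼ f̂(k)`; Grafakos 2014, Prop. 3.2.6 (8)). [cite: Grafakos2014, Prop. 3.2.6 (8)] -/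
theorem mFourierCoeff_ofReal_laplacian {θ : UnitAddTorus d → ℝ} (hθ : FunctionSpaces.Torus.IsSmooth θ) (k : d → ℤ) :
    mFourierCoeff (fun x => ((FunctionSpaces.Torus.laplacian θ x : ℝ) : ℂ)) k =
      -((4 * Real.pi ^ 2 * FunctionSpaces.Torus.freqNormSq k : ℝ) : ℂ) * mFourierCoeff (fun x => (θ x : ℂ)) k := by
  have hθC : FunctionSpaces.Torus.IsSmooth (fun x => (θ x : ℂ)) := hθ.ofReal_comp
  have h1 : (fun x => ((FunctionSpaces.Torus.laplacian θ x : ℝ) : ℂ)) =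
      fun x => ∑ i, FunctionSpaces.Torus.partialDeriv i (FunctionSpaces.Torus.partialDeriv i (fun y => (θ y : ℂ))) x := by
    funext x
    rw [FunctionSpaces.Torus.laplacian_eq_sum_partialDeriv_partialDeriv hθ, Complex.ofReal_sum]
    refine Finset.sum_congr rfl fun i _ => ?_
    have e1 : FunctionSpaces.Torus.partialDeriv i (fun y => (θ y : ℂ)) = fun y => ((FunctionSpaces.Torus.partialDeriv i θ y : ℝ) : ℂ) :=
      funext (FunctionSpaces.Torus.partialDeriv_ofReal_comp hθ i)
    rw [e1, FunctionSpaces.Torus.partialDeriv_ofReal_comp (hθ.partialDeriv i) i]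
  rw [h1, FunctionSpaces.Torus.mFourierCoeff_finset_sum _ fun i _ => ((hθC.partialDeriv i).partialDeriv i).integrable]
  simp_rw [FunctionSpaces.Torus.mFourierCoeff_partialDeriv (hθC.partialDeriv _),
    FunctionSpaces.Torus.mFourierCoeff_partialDeriv hθC, smul_smul, ← Finset.sum_smul, smul_eq_mul]
  congr 1
  rw [FunctionSpaces.Torus.freqNormSq]
  push_cast
  rw [Finset.mul_sum, ← Finset.sum_neg_distrib]
  refine Finset.sum_congr rfl fun i _ => ?_
  have hI : Complex.I * Complex.I = -1 := Complex.I_mul_I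
  linear_combination (2 * (Real.pi : ℂ) * (k i : ℂ)) ^ 2 * hI

/-! ## The heat phase: explicit Fourier modes (Cheskidov 2023, (4.9)–(4.10)) -/

namespace IsClassicalScalarTransportOn

variable {S : Set ℝ} {ν : ℝ} {v : ℝ → UnitAddTorus d → EuclideanSpace ℝ d}
  {θ : ℝ → UnitAddTorus d → ℝ}

/-- On a time window where the drift vanishes the scalar solves the heat equation:
`∂ₜθ = νΔθ` pointwise (Cheskidov 2023, (4.9)). [cite: Cheskidov2023, §4 (4.9)] -/
theorem timeDerivWithin_eq_of_drift_eq_zero (h : IsClassicalScalarTransportOn S ν v θ) {t : ℝ}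
    (ht : t ∈ S) (hv : v t = 0) (x : UnitAddTorus d) :
    FunctionSpaces.Torus.timeDerivWithin S θ t x = ν * FunctionSpaces.Torus.laplacian (θ t) x := by
  have := h.transport t ht x
  rw [hv] at this
  simpa using this

/-- The mode-wise heat equation: on a convex time set on which the drift vanishes,
`d/dt θ̂(t)(k) = -4π²ν|k|² θ̂(t)(k)` within `S` (Cheskidov 2023, (4.9) on the Fourier side). [cite: Cheskidov2023, §4 (4.9)] -/
theorem hasDerivWithinAt_mFourierCoeff_of_drift_eq_zero (h : IsClassicalScalarTransportOn S ν v θ)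
    (hS : Convex ℝ S) (hv : ∀ t ∈ S, v t = 0) (k : d → ℤ) {t : ℝ} (ht : t ∈ S) :
    HasDerivWithinAt (fun s => mFourierCoeff (fun x => (θ s x : ℂ)) k)
      (-((4 * Real.pi ^ 2 * ν * FunctionSpaces.Torus.freqNormSq k : ℝ) : ℂ) * mFourierCoeff (fun x => (θ t x : ℂ)) k) S t := by
  have h1 := hasDerivWithinAt_mFourierCoeff_ofReal h.smooth_scalar hS k ht
  have hθt : FunctionSpaces.Torus.IsSmooth (θ t) := h.smooth_scalar.isSmooth_slice ht
  have heq : (fun x => ((FunctionSpaces.Torus.timeDerivWithin S θ t x : ℝ) : ℂ)) =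
      fun x => (ν : ℂ) * ((FunctionSpaces.Torus.laplacian (θ t) x : ℝ) : ℂ) := by
    funext x
    rw [h.timeDerivWithin_eq_of_drift_eq_zero ht (hv t ht) x, Complex.ofReal_mul]
  rw [heq] at h1
  have hsm : mFourierCoeff (fun x => (ν : ℂ) * ((FunctionSpaces.Torus.laplacian (θ t) x : ℝ) : ℂ)) k =
      (ν : ℂ) * mFourierCoeff (fun x => ((FunctionSpaces.Torus.laplacian (θ t) x : ℝ) : ℂ)) k := by
    rw [← smul_eq_mul, ← FunctionSpaces.Torus.mFourierCoeff_const_smul]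
    rfl
  rw [hsm, mFourierCoeff_ofReal_laplacian hθt, ← mul_assoc] at h1
  refine h1.congr_deriv ?_
  congr 1
  push_cast
  ring

/-- **Explicit Fourier modes in the heat phase.** If the drift of a classical passive scalar
vanishes on `[T₁, T₂] ⊆ S`, then for every frequency `k` and `t ∈ [T₁, T₂]`,
`θ̂(t)(k) = e^{-4π²ν|k|²(t - T₁)} θ̂(T₁)(k)` (the function `e^{4π²ν|k|²t} θ̂(t)(k)` has zero
right derivative on `[T₁, T₂)` and is continuous on `[T₁, T₂]`; Cheskidov 2023, (4.9)–(4.10)). [cite: Cheskidov2023, §4 (4.9)–(4.10)] -/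
theorem mFourierCoeff_eq_exp_mul (h : IsClassicalScalarTransportOn S ν v θ) {T₁ T₂ : ℝ}
    (hT : T₁ < T₂) (hI : Icc T₁ T₂ ⊆ S) (hv : ∀ t ∈ Icc T₁ T₂, v t = 0) (k : d → ℤ) {t : ℝ}
    (ht : t ∈ Icc T₁ T₂) :
    mFourierCoeff (fun x => (θ t x : ℂ)) k =
      ((Real.exp (-(4 * Real.pi ^ 2 * ν * FunctionSpaces.Torus.freqNormSq k) * (t - T₁)) : ℝ) : ℂ) *
        mFourierCoeff (fun x => (θ T₁ x : ℂ)) k := by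
  have h' := h.restrict_Icc hT hI
  set c : ℝ := 4 * Real.pi ^ 2 * ν * FunctionSpaces.Torus.freqNormSq k with hc
  set f : ℝ → ℂ := fun s => mFourierCoeff (fun x => (θ s x : ℂ)) k with hf
  set g : ℝ → ℂ := fun s => ((Real.exp (c * (s - T₁)) : ℝ) : ℂ) * f s with hg
  have hfd : ∀ s ∈ Icc T₁ T₂, HasDerivWithinAt f (-(c : ℂ) * f s) (Icc T₁ T₂) s := by
    intro s hs
    have := h'.hasDerivWithinAt_mFourierCoeff_of_drift_eq_zero (convex_Icc T₁ T₂) hv k hs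
    simpa [hf, hc] using this
  have hed : ∀ s, HasDerivAt (fun s => ((Real.exp (c * (s - T₁)) : ℝ) : ℂ))
      ((Real.exp (c * (s - T₁)) * c : ℝ) : ℂ) s := by
    intro s
    have h1 : HasDerivAt (fun s => c * (s - T₁)) c s := by
      simpa using ((hasDerivAt_id s).sub_const T₁).const_mul c
    have h2 : HasDerivAt (fun s => Real.exp (c * (s - T₁))) (Real.exp (c * (s - T₁)) * c) s := h1.exp
    exact h2.ofReal_comp
  have hgd : ∀ s ∈ Icc T₁ T₂, HasDerivWithinAt g 0 (Icc T₁ T₂) s := by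
    intro s hs
    have h1 := ((hed s).hasDerivWithinAt).mul (hfd s hs)
    have h0 : ((Real.exp (c * (s - T₁)) * c : ℝ) : ℂ) * f s +
        ((Real.exp (c * (s - T₁)) : ℝ) : ℂ) * (-(c : ℂ) * f s) = 0 := by
      push_cast
      ring
    rw [h0] at h1
    exact h1
  have hgc : ContinuousOn g (Icc T₁ T₂) := fun s hs => (hgd s hs).continuousWithinAt
  have hconst := constant_of_has_deriv_right_zero hgc (fun s hs =>
    (hgd s (Ico_subset_Icc_self hs)).mono_of_mem_nhdsWithin
      (mem_of_superset (Icc_mem_nhdsGE hs.2) (Icc_subset_Icc hs.1 le_rfl))) t ht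
  simp only [hg, sub_self, mul_zero, Real.exp_zero, Complex.ofReal_one, one_mul] at hconst
  -- `e^{c(t-T₁)} f t = f T₁`
  have hexp : (Real.exp (c * (t - T₁)) : ℂ) ≠ 0 := Complex.ofReal_ne_zero.2 (Real.exp_ne_zero _)
  have : f t = ((Real.exp (-c * (t - T₁)) : ℝ) : ℂ) * f T₁ := by
    rw [← hconst, ← mul_assoc, ← Complex.ofReal_mul, ← Real.exp_add]
    simp
  simpa [hf, hc] using this

/-- Mode-wise consequences in the heat phase: low modes do not grow,
`|θ̂(t)(k)| ≤ |θ̂(T₁)(k)|` (`ν ≥ 0`; Cheskidov 2023, (4.8)). [cite: Cheskidov2023, §4 (4.8)] -/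
theorem enorm_mFourierCoeff_le (h : IsClassicalScalarTransportOn S ν v θ) (hν : 0 ≤ ν) {T₁ T₂ : ℝ}
    (hT : T₁ < T₂) (hI : Icc T₁ T₂ ⊆ S) (hv : ∀ t ∈ Icc T₁ T₂, v t = 0) (k : d → ℤ) {t : ℝ}
    (ht : t ∈ Icc T₁ T₂) :
    ‖mFourierCoeff (fun x => (θ t x : ℂ)) k‖ₑ ≤ ‖mFourierCoeff (fun x => (θ T₁ x : ℂ)) k‖ₑ := by
  rw [h.mFourierCoeff_eq_exp_mul hT hI hv k ht, enorm_mul]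
  refine mul_le_of_le_one_left (by simp) ?_
  rw [← ofReal_norm, Complex.norm_real, Real.norm_eq_abs, abs_of_pos (Real.exp_pos _),
    ENNReal.ofReal_le_one, Real.exp_le_one_iff]
  have : 0 ≤ 4 * Real.pi ^ 2 * ν * FunctionSpaces.Torus.freqNormSq k * (t - T₁) :=
    mul_nonneg (by have := FunctionSpaces.Torus.freqNormSq_nonneg k; positivity) (by linarith [ht.1])
  linarith

/-- Mode-wise consequences in the heat phase: modes with `|k|² ≥ R` decay at least like
`e^{-4π²νR(t-T₁)}`: `|θ̂(t)(k)|² ≤ e^{-8π²νR(t-T₁)} |θ̂(T₁)(k)|²` (`ν ≥ 0`; Cheskidov 2023,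
(4.10)). [cite: Cheskidov2023, §4 (4.10)] -/
theorem enorm_mFourierCoeff_sq_le_exp (h : IsClassicalScalarTransportOn S ν v θ) (hν : 0 ≤ ν)
    {T₁ T₂ : ℝ} (hT : T₁ < T₂) (hI : Icc T₁ T₂ ⊆ S) (hv : ∀ t ∈ Icc T₁ T₂, v t = 0) {R : ℝ}
    {k : d → ℤ} (hk : R ≤ FunctionSpaces.Torus.freqNormSq k) {t : ℝ} (ht : t ∈ Icc T₁ T₂) :
    ‖mFourierCoeff (fun x => (θ t x : ℂ)) k‖ₑ ^ 2 ≤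
      ENNReal.ofReal (Real.exp (-(8 * Real.pi ^ 2 * ν * R) * (t - T₁))) *
        ‖mFourierCoeff (fun x => (θ T₁ x : ℂ)) k‖ₑ ^ 2 := by
  rw [h.mFourierCoeff_eq_exp_mul hT hI hv k ht, enorm_mul, mul_pow, ← ofReal_norm, Complex.norm_real,
    Real.norm_eq_abs, abs_of_pos (Real.exp_pos _), ← ENNReal.ofReal_pow (Real.exp_pos _).le,
    ← Real.exp_nat_mul]
  refine mul_le_mul_of_nonneg_right (ENNReal.ofReal_le_ofReal (Real.exp_le_exp.2 ?_)) (by simp)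
  have h1 : 0 ≤ t - T₁ := by linarith [ht.1]
  have h2 : 0 ≤ 4 * Real.pi ^ 2 * ν := by positivity
  have h3 : 4 * Real.pi ^ 2 * ν * R * (t - T₁) ≤ 4 * Real.pi ^ 2 * ν * FunctionSpaces.Torus.freqNormSq k * (t - T₁) :=
    mul_le_mul_of_nonneg_right (mul_le_mul_of_nonneg_left hk h2) h1
  push_cast
  linarith

end IsClassicalScalarTransportOn

/-! ## Low modes and the splitting estimate (Cheskidov 2023, (4.8), (4.10)) -/

/-- The **low-mode energy** `lowModes N f = ∑_{|k|² ≤ N²} |f̂(k)|² ∈ [0, ∞]` of a real scalar on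
`T^d`: the squared `L²` norm `‖P_{≤N} f‖²_{L²}` of its Fourier truncation to the frequency ball
`Torus.freqBall N` (Cheskidov 2023, §4, `P_{≤Λ}`; equals `ofReal (∫ (scalarTruncate N f)²)` for
`f ∈ L²`, cf. `Torus.integral_sq_scalarTruncate` — kept here on the `ℝ≥0∞` side).
**Junk note:** `mFourierCoeff f k` is a Bochner integral, hence `0` for non-integrable `f`, so
`lowModes N f = 0` for such `f`; meaningful for `f ∈ L¹`. [cite: Cheskidov2023, §4 (4.6)] -/
def lowModes (N : ℕ) (f : UnitAddTorus d → ℝ) : ℝ≥0∞ :=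
  ∑ k ∈ FunctionSpaces.Torus.freqBall N, ‖mFourierCoeff (fun x => (f x : ℂ)) k‖ₑ ^ 2

/-- Unfolding `lowModes`. [folklore] -/
theorem lowModes_def (N : ℕ) (f : UnitAddTorus d → ℝ) :
    lowModes N f = ∑ k ∈ FunctionSpaces.Torus.freqBall N, ‖mFourierCoeff (fun x => (f x : ℂ)) k‖ₑ ^ 2 := rfl

omit [DecidableEq d] in
/-- Parseval for a real scalar in `L²(T^d)`: `∑ₖ |f̂(k)|² = ‖f‖²_{L²}` on the `ℝ≥0∞` side (through
the complexified function; the real-valued twin is `Torus.hasSum_sq_norm_mFourierCoeff_ofReal` of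
`TorusScalarTrigPoly`; Grafakos 2014, Prop. 3.2.7). [cite: Grafakos2014, Prop. 3.2.7] -/
theorem tsum_enorm_sq_mFourierCoeff_ofReal {f : UnitAddTorus d → ℝ} (hf : MemLp f 2 volume) :
    ∑' k, ‖mFourierCoeff (fun x => (f x : ℂ)) k‖ₑ ^ 2 = eLpNorm f 2 volume ^ 2 := by
  have hfC : MemLp (fun x => (f x : ℂ)) 2 volume := hf.ofReal
  rw [FunctionSpaces.Torus.tsum_enorm_sq_mFourierCoeff_eq_eLpNorm_sq hfC]
  congr 1
  refine eLpNorm_congr_norm_ae (Eventually.of_forall fun x => ?_)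
  simp

/-- Low modes are bounded by the total energy (Bessel): `∑_{|k| ≤ N} |f̂(k)|² ≤ ‖f‖²_{L²}`. [folklore] -/
theorem lowModes_le_eLpNorm_sq (N : ℕ) {f : UnitAddTorus d → ℝ} (hf : MemLp f 2 volume) :
    lowModes N f ≤ eLpNorm f 2 volume ^ 2 := by
  rw [lowModes, ← tsum_enorm_sq_mFourierCoeff_ofReal hf]
  exact ENNReal.sum_le_tsum _

namespace IsClassicalScalarTransportOn

variable {S : Set ℝ} {ν : ℝ} {v : ℝ → UnitAddTorus d → EuclideanSpace ℝ d}
  {θ : ℝ → UnitAddTorus d → ℝ}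

/-- **The splitting estimate in the heat phase** (Cheskidov 2023, (4.8) with (4.10)): if the
drift of a classical passive scalar (`ν ≥ 0`) vanishes on `[T₁, T₂] ⊆ S` (`T₁ < T₂`), then for
`t ∈ [T₁, T₂]` and every truncation radius `N`,
`‖θ(t)‖²_{L²} ≤ ∑_{|k| ≤ N} |θ̂(T₁)(k)|² + e^{-8π²νN²(t-T₁)} ‖θ(T₁)‖²_{L²}`
(Parseval; the modes in the ball `freqBall N` do not grow, the modes off the ball have
`|k|² > N²` and decay exponentially). [cite: Cheskidov2023, §4 (4.8)–(4.11)] -/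
theorem eLpNorm_sq_le_lowModes_add_exp (h : IsClassicalScalarTransportOn S ν v θ) (hν : 0 ≤ ν)
    {T₁ T₂ : ℝ} (hT : T₁ < T₂) (hI : Icc T₁ T₂ ⊆ S) (hv : ∀ t ∈ Icc T₁ T₂, v t = 0) (N : ℕ)
    {t : ℝ} (ht : t ∈ Icc T₁ T₂) :
    eLpNorm (θ t) 2 volume ^ 2 ≤
      lowModes N (θ T₁) +
        ENNReal.ofReal (Real.exp (-(8 * Real.pi ^ 2 * ν * (N : ℝ) ^ 2) * (t - T₁))) *
          eLpNorm (θ T₁) 2 volume ^ 2 := by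
  have hθt : FunctionSpaces.Torus.IsSmooth (θ t) := h.smooth_scalar.isSmooth_slice (hI ht)
  have hθ1 : FunctionSpaces.Torus.IsSmooth (θ T₁) := h.smooth_scalar.isSmooth_slice (hI (left_mem_Icc.2 hT.le))
  set E : ℝ≥0∞ := ENNReal.ofReal (Real.exp (-(8 * Real.pi ^ 2 * ν * (N : ℝ) ^ 2) * (t - T₁))) with hE
  set a : (d → ℤ) → ℝ≥0∞ := fun k => ‖mFourierCoeff (fun x => (θ t x : ℂ)) k‖ₑ ^ 2 with ha
  set b : (d → ℤ) → ℝ≥0∞ := fun k => ‖mFourierCoeff (fun x => (θ T₁ x : ℂ)) k‖ₑ ^ 2 with hb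
  rw [← tsum_enorm_sq_mFourierCoeff_ofReal (hθt.memLp 2), ← tsum_enorm_sq_mFourierCoeff_ofReal (hθ1.memLp 2),
    ← ENNReal.sum_add_tsum_compl (FunctionSpaces.Torus.freqBall N) a, lowModes]
  refine add_le_add (Finset.sum_le_sum fun k _ => ?_) ?_
  · exact pow_le_pow_left' (h.enorm_mFourierCoeff_le hν hT hI hv k ht) 2
  · calc ∑' k : ↥((FunctionSpaces.Torus.freqBall (d := d) N : Set (d → ℤ)))ᶜ, a k
        ≤ ∑' k : ↥((FunctionSpaces.Torus.freqBall (d := d) N : Set (d → ℤ)))ᶜ, E * b k := by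
          refine ENNReal.tsum_le_tsum fun k => ?_
          have hk : (k : d → ℤ) ∉ FunctionSpaces.Torus.freqBall N := by
            have hk' := k.2
            rw [Set.mem_compl_iff, Finset.mem_coe] at hk'
            exact hk'
          exact h.enorm_mFourierCoeff_sq_le_exp hν hT hI hv (FunctionSpaces.Torus.not_mem_freqBall.1 hk).le ht
      _ = E * ∑' k : ↥((FunctionSpaces.Torus.freqBall (d := d) N : Set (d → ℤ)))ᶜ, b k := ENNReal.tsum_mul_left
      _ ≤ E * ∑' k, b k := by
          gcongr
          exact ENNReal.tsum_comp_le_tsum_of_injective Subtype.val_injective b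

end IsClassicalScalarTransportOn

/-! ## Low modes of an `Ḣ⁻¹`-small mean-zero scalar (Cheskidov 2023, (4.6)–(4.7)) -/

omit [DecidableEq d] in
/-- The zeroth Fourier coefficient of a mean-zero real scalar vanishes. [folklore] -/
theorem mFourierCoeff_ofReal_zero_of_hasZeroMean {f : UnitAddTorus d → ℝ}
    (hf : FunctionSpaces.Torus.HasZeroMean f) : mFourierCoeff (fun x => (f x : ℂ)) 0 = 0 := by
  rw [FunctionSpaces.Torus.mFourierCoeff_eq_integral_volume]
  simp only [neg_zero, smul_eq_mul]
  have h1 : (fun x : UnitAddTorus d => (mFourier 0 x : ℂ) * (f x : ℂ)) = fun x => (f x : ℂ) := by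
    funext x
    rw [mFourier_zero]
    simp
  rw [h1, integral_complex_ofReal, show (∫ x, f x) = 0 from hf, Complex.ofReal_zero]

/-- **Low modes are controlled by the `Ḣ⁻¹` norm** (Cheskidov 2023, (4.6):
`‖P_{≤Λ}ρ‖_{L²} ≤ Λ ‖P_{≤Λ}ρ‖_{H⁻¹}`, squared): for a mean-zero scalar with `‖ρ‖_{Ḣ⁻¹} ≤ M`,
`∑_{|k| ≤ N} |ρ̂(k)|² ≤ N² M²` (on the ball `|k|² ≤ N²`, and the zero mode vanishes). [cite: Cheskidov2023, §4 (4.6)] -/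
theorem lowModes_le_of_eHomSobolevSeminorm_le {ρ : UnitAddTorus d → ℝ} (hmean : FunctionSpaces.Torus.HasZeroMean ρ)
    {M : ℝ≥0∞} (hH : FunctionSpaces.Torus.eHomSobolevSeminorm (-1) (fun x => (ρ x : ℂ)) ≤ M) (N : ℕ) :
    lowModes N ρ ≤ ENNReal.ofReal ((N : ℝ) ^ 2) * M ^ 2 := by
  set C : ℝ≥0∞ := ENNReal.ofReal ((N : ℝ) ^ 2) with hC
  set w : (d → ℤ) → ℝ≥0∞ := fun k =>
    (if k = 0 then 0 else ENNReal.ofReal (FunctionSpaces.Torus.freqNormSq k ^ (-1 : ℝ))) *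
      ‖mFourierCoeff (fun x => (ρ x : ℂ)) k‖ₑ ^ 2 with hw
  have hHsq : ∑' k, w k = FunctionSpaces.Torus.eHomSobolevSeminorm (-1) (fun x => (ρ x : ℂ)) ^ 2 := by
    rw [FunctionSpaces.Torus.eHomSobolevSeminorm, ENNReal.rpow_half_sq]
  have hterm : ∀ k ∈ FunctionSpaces.Torus.freqBall N, ‖mFourierCoeff (fun x => (ρ x : ℂ)) k‖ₑ ^ 2 ≤ C * w k := by
    intro k hk
    by_cases hk0 : k = 0
    · subst hk0
      rw [mFourierCoeff_ofReal_zero_of_hasZeroMean hmean]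
      simp
    · have hpos : 0 < FunctionSpaces.Torus.freqNormSq k := freqNormSq_pos_of_ne_zero hk0
      have hle : FunctionSpaces.Torus.freqNormSq k ≤ (N : ℝ) ^ 2 := FunctionSpaces.Torus.mem_freqBall.1 hk
      have h1 : (1 : ℝ≥0∞) ≤ C * ENNReal.ofReal (FunctionSpaces.Torus.freqNormSq k ^ (-1 : ℝ)) := by
        rw [hC, Real.rpow_neg_one, ← ENNReal.ofReal_mul (by positivity), ENNReal.one_le_ofReal,
          ← div_eq_mul_inv, one_le_div hpos]
        exact hle
      calc ‖mFourierCoeff (fun x => (ρ x : ℂ)) k‖ₑ ^ 2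
          = 1 * ‖mFourierCoeff (fun x => (ρ x : ℂ)) k‖ₑ ^ 2 := (one_mul _).symm
        _ ≤ (C * ENNReal.ofReal (FunctionSpaces.Torus.freqNormSq k ^ (-1 : ℝ))) *
              ‖mFourierCoeff (fun x => (ρ x : ℂ)) k‖ₑ ^ 2 := mul_le_mul_of_nonneg_right h1 (by simp)
        _ = C * w k := by
          rw [hw]
          dsimp only
          rw [if_neg hk0, mul_assoc]
  calc lowModes N ρ = ∑ k ∈ FunctionSpaces.Torus.freqBall N, ‖mFourierCoeff (fun x => (ρ x : ℂ)) k‖ₑ ^ 2 := rfl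
    _ ≤ ∑ k ∈ FunctionSpaces.Torus.freqBall N, C * w k := Finset.sum_le_sum hterm
    _ = C * ∑ k ∈ FunctionSpaces.Torus.freqBall N, w k := (Finset.mul_sum _ _ _).symm
    _ ≤ C * ∑' k, w k := by
        gcongr
        exact ENNReal.sum_le_tsum _
    _ = C * FunctionSpaces.Torus.eHomSobolevSeminorm (-1) (fun x => (ρ x : ℂ)) ^ 2 := by rw [hHsq]
    _ ≤ C * M ^ 2 := by gcongr

omit [DecidableEq d] in
/-- `‖a + b‖ₑ² ≤ 2‖a‖ₑ² + 2‖b‖ₑ²` in a seminormed group (local copy of the elementary bound, cf.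
`Literature.Analysis.FunctionSpaces.BMOInv.enorm_add_sq_le`, whose file is not imported here). [folklore] -/
theorem enorm_add_sq_le_two_mul {E : Type*} [SeminormedAddCommGroup E] (a b : E) :
    ‖a + b‖ₑ ^ 2 ≤ 2 * ‖a‖ₑ ^ 2 + 2 * ‖b‖ₑ ^ 2 := by
  have h : ‖a + b‖ ^ 2 ≤ 2 * ‖a‖ ^ 2 + 2 * ‖b‖ ^ 2 := by
    have h1 : ‖a + b‖ ^ 2 ≤ (‖a‖ + ‖b‖) ^ 2 := pow_le_pow_left₀ (norm_nonneg _) (norm_add_le a b) 2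
    nlinarith [h1, sq_nonneg (‖a‖ - ‖b‖)]
  calc ‖a + b‖ₑ ^ 2 = ENNReal.ofReal (‖a + b‖ ^ 2) := by
        rw [← ofReal_norm, ENNReal.ofReal_pow (norm_nonneg _)]
    _ ≤ ENNReal.ofReal (2 * ‖a‖ ^ 2 + 2 * ‖b‖ ^ 2) := ENNReal.ofReal_le_ofReal h
    _ = 2 * ‖a‖ₑ ^ 2 + 2 * ‖b‖ₑ ^ 2 := by
        rw [ENNReal.ofReal_add (by positivity) (by positivity), ENNReal.ofReal_mul zero_le_two,
          ENNReal.ofReal_mul zero_le_two, ENNReal.ofReal_pow (norm_nonneg _),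
          ENNReal.ofReal_pow (norm_nonneg _), ofReal_norm, ofReal_norm, ENNReal.ofReal_ofNat]

/-- **Low modes of a perturbation** (Cheskidov 2023, (4.7), squared form):
`∑_{box} |θ̂(k)|² ≤ 2‖θ - ρ‖²_{L²} + 2∑_{box} |ρ̂(k)|²` for `θ, ρ ∈ L²(T^d)`
(`θ̂ = (θ-ρ)^ + ρ̂` mode by mode, `|a+b|² ≤ 2|a|² + 2|b|²`, and Bessel's inequality for `θ - ρ`). [cite: Cheskidov2023, §4 (4.7)] -/
theorem lowModes_le_two_mul_add (N : ℕ) {θ ρ : UnitAddTorus d → ℝ} (hθ : MemLp θ 2 volume)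
    (hρ : MemLp ρ 2 volume) :
    lowModes N θ ≤ 2 * eLpNorm (θ - ρ) 2 volume ^ 2 + 2 * lowModes N ρ := by
  have hdiff : MemLp (θ - ρ) 2 volume := hθ.sub hρ
  have hsplit : ∀ k, mFourierCoeff (fun x => (θ x : ℂ)) k =
      mFourierCoeff (fun x => ((θ - ρ) x : ℂ)) k + mFourierCoeff (fun x => (ρ x : ℂ)) k := by
    intro k
    rw [← FunctionSpaces.Torus.mFourierCoeff_add (hdiff.integrable one_le_two).ofReal
      (hρ.integrable one_le_two).ofReal]
    congr 1
    funext x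
    simp
  calc lowModes N θ
      = ∑ k ∈ FunctionSpaces.Torus.freqBall N,
          ‖mFourierCoeff (fun x => ((θ - ρ) x : ℂ)) k + mFourierCoeff (fun x => (ρ x : ℂ)) k‖ₑ ^ 2 := by
        rw [lowModes]
        exact Finset.sum_congr rfl fun k _ => by rw [hsplit k]
    _ ≤ ∑ k ∈ FunctionSpaces.Torus.freqBall N, (2 * ‖mFourierCoeff (fun x => ((θ - ρ) x : ℂ)) k‖ₑ ^ 2 +
          2 * ‖mFourierCoeff (fun x => (ρ x : ℂ)) k‖ₑ ^ 2) :=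
        Finset.sum_le_sum fun k _ => enorm_add_sq_le_two_mul _ _
    _ = 2 * lowModes N (θ - ρ) + 2 * lowModes N ρ := by
        rw [Finset.sum_add_distrib, ← Finset.mul_sum, ← Finset.mul_sum, lowModes, lowModes]
    _ ≤ 2 * eLpNorm (θ - ρ) 2 volume ^ 2 + 2 * lowModes N ρ := by
        gcongr
        exact lowModes_le_eLpNorm_sq N hdiff

end Torus

end Literature.Analysis.FluidPDE

end
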